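import Literature.NumberTheory.Automorphic.Liu2021.Thm418AsPrinted
import HarnessLib

/-!
# [Liu2021, Thm. 4.18] AS PRINTED is invariant under isomorphism of the datum

Structural lemma (no mathematics of [Liu2021] is asserted): if `D : Thm418Data F E` satisfies `Thm418AsPrinted D`, then so does
every datum `D′` obtained from `D` by (i) replacing the group `𝔾(𝔸_F^∞)` by an isomorphic topological group `G′` acting on the SAME
`Ω(μ)` and the same `Hom_E(A_K, A_μ)_ℚ` through a topological-group isomorphism `φ : G′ ≃ D.G` (levels `K′ ↦ φ(K′)`), and
(ii) replacing the index sets `ε, χ` and the summands `ω(μ, ε, χ)` by new ones that are, index by index along a bijection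
`e : D′.AdmIndex ≃ D.AdmIndex` lying over an injective map of collections `fε`, `ℂ`-linearly isomorphic to the old summands
equivariantly along `φ`.  This is the transport-of-structure step that reads the printed theorem for one presentation of the
datum from the printed theorem for another (e.g. the datum of a hermitian space `𝕍` at the label `μᶜ` relabelled along `g ↦ ḡ`
versus the datum of the conjugate space `𝕍^{(c)}` at `μ`).  THEOREMS + one `def` (the transported datum, by explicit formula).
Seat prover-pub-hodgeaudit-ident-2-g2-0 (checker's desk lemma (P3)); HC_CM is NOT proved; nothing here is a verdict.

References: [Liu2021] Y. Liu, *Fourier–Jacobi cycles and arithmetic relative trace formula*, Camb. J. Math. 9 (2021), Thm. 4.18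
(FJcycle.tex l. 2232–2245), Def. 4.11–4.12, Rem. 4.4.
-/

set_option autoImplicit false

noncomputable section

open NumberField TensorProduct DirectSum

namespace Literature.NumberTheory.Automorphic.Liu2021

namespace Thm418Data

variable {F E : Type} [Field F] [NumberField F] [IsTotallyReal F] [Field E] [NumberField E] [Algebra F E]
  [IsTotallyComplex E] [Algebra.IsQuadraticExtension F E]

/-- **The transported datum**: same `n, 𝕍, μ, 𝒜(μ), Ω(μ)`; the group `G′` acts on `Ω(μ)` through `φ : G′ ≃ 𝔾(𝔸_F^∞)` and the
levels are read through `φ` (`Hom_E(A_{K′}, A_μ)_ℚ := Hom_E(A_{φ(K′)}, A_μ)_ℚ`); new collections `Eps′`, `epsOf′`, characters `Chi′`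
and summands `ω′(ε′, χ′)` with their `G′`-actions. [cite: Liu2021, Thm. 4.18 (l. 2232–2245), Def. 4.11–4.12] -/
def transport (D : Thm418Data F E) (G' : Type) [Group G'] [TopologicalSpace G'] [IsTopologicalGroup G']
    (φ : G' ≃ₜ* D.G) (Eps' : Type) (epsOf' : E → Eps') (Chi' : Type) (omega' : Eps' → Chi' → Type)
    [∀ ε χ, AddCommGroup (omega' ε χ)] [∀ ε χ, Module ℂ (omega' ε χ)]
    (rho' : ∀ ε χ, Representation ℂ G' (omega' ε χ)) : Thm418Data F E where
  n := D.n
  two_le_n := D.two_le_n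
  𝕍 := D.𝕍
  G := G'
  Eps := Eps'
  epsOf := epsOf'
  Chi := Chi'
  μ := D.μ
  isConjugateSymplectic := D.isConjugateSymplectic
  hasWeight_one := D.hasWeight_one
  Obj := D.Obj
  omega := omega'
  rho := rho'
  Ω := D.Ω
  rhoΩ := D.rhoΩ.comp φ.toMulEquiv.toMonoidHom
  HomK := fun K' Dμ => D.HomK (K'.map φ.toMulEquiv.toMonoidHom) Dμ
  res := fun K' Dμ => D.res (K'.map φ.toMulEquiv.toMonoidHom) Dμ

section Transport

variable (D : Thm418Data F E) (G' : Type) [Group G'] [TopologicalSpace G'] [IsTopologicalGroup G']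
  (φ : G' ≃ₜ* D.G) (Eps' : Type) (epsOf' : E → Eps') (Chi' : Type) (omega' : Eps' → Chi' → Type)
  [∀ ε χ, AddCommGroup (omega' ε χ)] [∀ ε χ, Module ℂ (omega' ε χ)]
  (rho' : ∀ ε χ, Representation ℂ G' (omega' ε χ))

omit [IsTopologicalGroup G'] in
/-- the level `φ(K′)` as a set is the image of `K′`. [folklore] -/
private theorem coe_map_eq_image (K' : Subgroup G') :
    ((K'.map φ.toMulEquiv.toMonoidHom : Subgroup D.G) : Set D.G) = φ.toHomeomorph '' (K' : Set G') := by
  ext x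
  constructor
  · rintro ⟨y, hy, rfl⟩
    exact ⟨y, hy, rfl⟩
  · rintro ⟨y, hy, rfl⟩
    exact ⟨y, hy, rfl⟩

omit [IsTopologicalGroup G'] in
/-- an open compact subgroup maps to an open compact subgroup under a topological-group isomorphism. [folklore] -/
private theorem isOpenCompact_map {K' : Subgroup G'} (hK : IsOpenCompact K') :
    IsOpenCompact (K'.map φ.toMulEquiv.toMonoidHom) := by
  refine ⟨?_, ?_⟩
  · rw [coe_map_eq_image]
    exact φ.toHomeomorph.isOpenMap _ hK.1
  · rw [coe_map_eq_image]
    exact hK.2.image φ.toHomeomorph.continuous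

omit [IsTopologicalGroup G'] in
/-- the preimage of an open compact subgroup under a topological-group isomorphism is open compact. [folklore] -/
private theorem isOpenCompact_comap {K : Subgroup D.G} (hK : IsOpenCompact K) :
    IsOpenCompact (K.comap φ.toMulEquiv.toMonoidHom : Subgroup G') := by
  have hset : ((K.comap φ.toMulEquiv.toMonoidHom : Subgroup G') : Set G') = φ.toHomeomorph ⁻¹' (K : Set D.G) := rfl
  refine ⟨?_, ?_⟩
  · rw [hset]
    exact hK.1.preimage φ.toHomeomorph.continuous
  · rw [hset, φ.toHomeomorph.isCompact_preimage]
    exact hK.2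

/-- the invariants of `K′` in the transported datum are the invariants of `φ(K′)`. [cite: Liu2021, Thm. 4.18 (1)] -/
theorem invariants_transport (K' : Subgroup G') :
    (D.transport G' φ Eps' epsOf' Chi' omega' rho').invariants K' = D.invariants (K'.map φ.toMulEquiv.toMonoidHom) := by
  ext x
  constructor
  · rintro hx k ⟨k', hk', rfl⟩
    exact hx k' hk'
  · intro hx k' hk'
    exact hx _ ⟨k', hk', rfl⟩

/-- **TRANSPORT OF [Liu2021, Thm. 4.18] AS PRINTED along an isomorphism of the datum.**  Hypotheses: `h : Thm418AsPrinted D`;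
an index bijection `e : D′.AdmIndex ≃ D.AdmIndex` over an injective map of collections `fε` (`(e i′).ε = fε (i′.ε)`) carrying
`D′`-admissible collections to `D`-admissible ones; summand isomorphisms `Ωᵢ i′ : ω′_{i′} ≃ₗ[ℂ] ω_{e i′}` intertwining `ρ′(g′)`
with `ρ(φ g′)`.  Conclusion: `Thm418AsPrinted D′` for the transported datum `D′ = D.transport …`.
[cite: Liu2021, Thm. 4.18 (l. 2232–2245)] -/
theorem thm418AsPrinted_transport (h : Liu2021.Thm418AsPrinted D)
    (e : (D.transport G' φ Eps' epsOf' Chi' omega' rho').AdmIndex ≃ D.AdmIndex)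
    (fε : Eps' → D.Eps) (hfε : Function.Injective fε)
    (he : ∀ i' : (D.transport G' φ Eps' epsOf' Chi' omega' rho').AdmIndex, (e i').1.1 = fε i'.1.1)
    (hadm : ∀ ε' : Eps', (D.transport G' φ Eps' epsOf' Chi' omega' rho').IsAdmissible ε' → D.IsAdmissible (fε ε'))
    (Ωᵢ : ∀ i' : (D.transport G' φ Eps' epsOf' Chi' omega' rho').AdmIndex, (D.transport G' φ Eps' epsOf' Chi' omega' rho').omegaAt i' ≃ₗ[ℂ] D.omegaAt (e i'))
    (hΩ : ∀ (i' : (D.transport G' φ Eps' epsOf' Chi' omega' rho').AdmIndex) (g' : G') (y : (D.transport G' φ Eps' epsOf' Chi' omega' rho').omegaAt i'),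
      Ωᵢ i' ((D.transport G' φ Eps' epsOf' Chi' omega' rho').rhoAt i' g' y) = D.rhoAt (e i') (φ g') (Ωᵢ i' y)) :
    Liu2021.Thm418AsPrinted (D.transport G' φ Eps' epsOf' Chi' omega' rho') := by
  obtain ⟨Φ, hmain, h1, h2, h3⟩ := h
  -- inverse equivariance of the summand isomorphisms
  have hΩsymm : ∀ (i' : (D.transport G' φ Eps' epsOf' Chi' omega' rho').AdmIndex) (g' : G') (z : D.omegaAt (e i')),
      (Ωᵢ i').symm (D.rhoAt (e i') (φ g') z) = (D.transport G' φ Eps' epsOf' Chi' omega' rho').rhoAt i' g' ((Ωᵢ i').symm z) := by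
    intro i' g' z
    apply (Ωᵢ i').injective
    rw [LinearEquiv.apply_symm_apply, hΩ, LinearEquiv.apply_symm_apply]
  -- the transported isomorphism `Φ′ : ℂ ⊗ Ω(μ) ≃ ⨁_{i′} ω′_{i′}`: `Φ`, reindex by `e`, then `Ωᵢ⁻¹` componentwise
  let R : (⨁ i : D.AdmIndex, D.omegaAt i) ≃ₗ[ℂ] ⨁ i' : (D.transport G' φ Eps' epsOf' Chi' omega' rho').AdmIndex, D.omegaAt (e i') :=
    DirectSum.lequivCongrLeft ℂ e.symm
  let C : (⨁ i' : (D.transport G' φ Eps' epsOf' Chi' omega' rho').AdmIndex, D.omegaAt (e i')) ≃ₗ[ℂ] ⨁ i' : (D.transport G' φ Eps' epsOf' Chi' omega' rho').AdmIndex, (D.transport G' φ Eps' epsOf' Chi' omega' rho').omegaAt i' :=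
    LinearEquiv.ofLinear
      (DirectSum.lmap fun i' => ((Ωᵢ i').symm : D.omegaAt (e i') ≃ₗ[ℂ] (D.transport G' φ Eps' epsOf' Chi' omega' rho').omegaAt i').toLinearMap)
      (DirectSum.lmap fun i' => (Ωᵢ i').toLinearMap)
      (by
        apply LinearMap.ext
        intro x
        apply DFinsupp.ext
        intro i'
        simp only [LinearMap.comp_apply, DirectSum.lmap_apply, LinearEquiv.coe_coe, LinearEquiv.symm_apply_apply,
          LinearMap.id_apply])
      (by
        apply LinearMap.ext
        intro x
        apply DFinsupp.ext
        intro i'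
        simp only [LinearMap.comp_apply, DirectSum.lmap_apply, LinearEquiv.coe_coe, LinearEquiv.apply_symm_apply,
          LinearMap.id_apply])
  let Φ' : (ℂ ⊗[fieldOfValues E D.μ] D.Ω) ≃ₗ[ℂ] (⨁ i' : (D.transport G' φ Eps' epsOf' Chi' omega' rho').AdmIndex, (D.transport G' φ Eps' epsOf' Chi' omega' rho').omegaAt i') := Φ.trans (R.trans C)
  have hΦ' : ∀ (x : ℂ ⊗[fieldOfValues E D.μ] D.Ω) (i' : (D.transport G' φ Eps' epsOf' Chi' omega' rho').AdmIndex), Φ' x i' = (Ωᵢ i').symm (Φ x (e i')) := by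
    intro x i'
    show C (R (Φ x)) i' = _
    simp only [C, R, LinearEquiv.ofLinear_apply, DirectSum.lmap_apply, LinearEquiv.coe_coe]
    rfl
  refine ⟨Φ', ?_, ?_, ?_, ?_⟩
  · -- (main) equivariance along `φ`
    intro g' x i'
    change Φ' ((D.rhoΩ (φ g')).baseChange ℂ x) i' = (D.transport G' φ Eps' epsOf' Chi' omega' rho').rhoAt i' g' (Φ' x i')
    rw [hΦ', hΦ', hmain, hΩsymm]
  · -- (1) levels through `φ`
    intro Dμ
    obtain ⟨K₀, hK₀, hK⟩ := h1 Dμ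
    refine ⟨K₀.comap φ.toMulEquiv.toMonoidHom, D.isOpenCompact_comap G' φ hK₀, fun K' hK' hle => ?_⟩
    have hle' : K'.map φ.toMulEquiv.toMonoidHom ≤ K₀ := Subgroup.map_le_iff_le_comap.2 hle
    obtain ⟨hinj, hrange⟩ := hK (K'.map φ.toMulEquiv.toMonoidHom) (D.isOpenCompact_map G' φ hK') hle'
    refine ⟨hinj, ?_⟩
    change Set.range (D.res (K'.map φ.toMulEquiv.toMonoidHom) Dμ) = (D.transport G' φ Eps' epsOf' Chi' omega' rho').invariants K'
    rw [hrange, invariants_transport]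
  · -- (2) pairwise non-isomorphy
    intro i' j' hij
    obtain ⟨f, hf⟩ := hij
    have hiso : D.AreIsomorphic (e i') (e j') := by
      refine ⟨((Ωᵢ i').symm.trans f).trans (Ωᵢ j'), fun g v => ?_⟩
      obtain ⟨g', rfl⟩ := φ.surjective g
      simp only [LinearEquiv.trans_apply]
      rw [hΩsymm, hf, hΩ]
    exact e.injective (h2 _ _ hiso)
  · -- (3) Galois stability of the `ε′`-blocks
    intro ε' hε' σ x hx i' hi'
    have hx0 : ∀ i : D.AdmIndex, i.1.1 ≠ fε ε' → Φ x i = 0 := by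
      intro i hi
      obtain ⟨i'', rfl⟩ := e.surjective i
      have hne : i''.1.1 ≠ ε' := by
        intro heq
        apply hi
        rw [he, heq]
      have hz : Φ' x i'' = 0 := hx i'' hne
      rw [hΦ'] at hz
      simpa using hz
    have hne' : (e i').1.1 ≠ fε ε' := by
      rw [he]
      exact fun heq => hi' (hfε heq)
    have key := h3 (fε ε') (hadm ε' hε') σ x hx0 (e i') hne'
    change Φ' (D.galoisAct σ x) i' = 0
    rw [hΦ', key, map_zero]

end Transport

/-! ## GAP-READ-1 g37 DESK PROBE (reader 1, NOT filed) — the ROUND TRIP and the BACKWARD direction.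
Lines 1–198 above = ident-2 g2's (P3) `Thm418Transport.lean` bd9beba36cc1a90d VERBATIM (imports + `transport` +
`thm418AsPrinted_transport`).  Below: `transport` along `φ` then along `φ.symm` (with the original collections, characters and
summands put back) IS the original datum — a propositional, not definitional, equality (`rhoΩ ∘ φ ∘ φ⁻¹`, levels
`(K.map φ⁻¹).map φ`) — and hence the BACKWARD transfer `Thm418AsPrinted (D.transport …) → Thm418AsPrinted D` (GAP-READ-1 §AD3 (ii)).
Kernel only; one auxiliary `def` (`reindex`, by explicit formula), theorems; no `sorry`, no named fact.  HC_CM is NOT proved. -/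

section RoundTrip

variable (D : Thm418Data F E)

/-- auxiliary presentation: same datum, `𝔾`-action on `Ω(μ)` replaced by `ρ` and levels read through `f`
(plumbing for the round trip of `transport`). [cite: Liu2021, Thm. 4.18 (l. 2232–2245), Def. 4.11–4.12] -/
def reindex (ρ : Representation (fieldOfValues E D.μ) D.G D.Ω) (f : Subgroup D.G → Subgroup D.G) : Thm418Data F E where
  n := D.n
  two_le_n := D.two_le_n
  𝕍 := D.𝕍
  G := D.G
  Eps := D.Eps
  epsOf := D.epsOf
  Chi := D.Chi
  μ := D.μ
  isConjugateSymplectic := D.isConjugateSymplectic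
  hasWeight_one := D.hasWeight_one
  Obj := D.Obj
  omega := D.omega
  rho := D.rho
  Ω := D.Ω
  rhoΩ := ρ
  HomK := fun K Dμ => D.HomK (f K) Dμ
  res := fun K Dμ => D.res (f K) Dμ

/-- `reindex` at the datum's own action and the identity on levels is the datum (structure eta). [folklore] -/
private theorem reindex_self : D.reindex D.rhoΩ id = D := by
  cases D
  rfl

variable (G' : Type) [Group G'] [TopologicalSpace G'] [IsTopologicalGroup G']
  (φ : G' ≃ₜ* D.G) (Eps' : Type) (epsOf' : E → Eps') (Chi' : Type) (omega' : Eps' → Chi' → Type)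
  [∀ ε χ, AddCommGroup (omega' ε χ)] [∀ ε χ, Module ℂ (omega' ε χ)]
  (rho' : ∀ ε χ, Representation ℂ G' (omega' ε χ))

/-- the double transport, unfolded: a `reindex` along `φ ∘ φ⁻¹` (by `rfl`). [folklore] -/
private theorem transport_transport_symm_eq_reindex :
    (D.transport G' φ Eps' epsOf' Chi' omega' rho').transport D.G φ.symm D.Eps D.epsOf D.Chi D.omega D.rho =
      D.reindex ((D.rhoΩ.comp φ.toMulEquiv.toMonoidHom).comp φ.symm.toMulEquiv.toMonoidHom)
        (fun K => (K.map φ.symm.toMulEquiv.toMonoidHom).map φ.toMulEquiv.toMonoidHom) :=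
  rfl

omit [IsTopologicalGroup G'] in
/-- `φ ∘ φ⁻¹ = id` on the group of the datum, as monoid homs. [folklore] -/
private theorem toMonoidHom_comp_symm_toMonoidHom :
    φ.toMulEquiv.toMonoidHom.comp φ.symm.toMulEquiv.toMonoidHom = MonoidHom.id D.G :=
  MonoidHom.ext fun g => φ.apply_symm_apply g

/-- **ROUND TRIP**: transporting along `φ` and back along `φ.symm` (original collections, characters, summands restored)
returns the datum ON THE NOSE — propositionally. [cite: Liu2021, Thm. 4.18 (l. 2232–2245), Def. 4.11–4.12] -/
theorem transport_transport_symm :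
    (D.transport G' φ Eps' epsOf' Chi' omega' rho').transport D.G φ.symm D.Eps D.epsOf D.Chi D.omega D.rho = D := by
  have hρ : (D.rhoΩ.comp φ.toMulEquiv.toMonoidHom).comp φ.symm.toMulEquiv.toMonoidHom = D.rhoΩ := by
    rw [MonoidHom.comp_assoc, toMonoidHom_comp_symm_toMonoidHom, MonoidHom.comp_id]
  have hf : (fun K : Subgroup D.G => (K.map φ.symm.toMulEquiv.toMonoidHom).map φ.toMulEquiv.toMonoidHom) = id := by
    funext K
    rw [Subgroup.map_map, toMonoidHom_comp_symm_toMonoidHom, Subgroup.map_id]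
    rfl
  rw [transport_transport_symm_eq_reindex, hρ, hf, reindex_self]

/-- **BACKWARD TRANSFER** (GAP-READ-1 §AD3 (ii)): [Liu2021, Thm. 4.18] AS PRINTED for the transported presentation
`D.transport G′ φ …` implies it for `D` itself — given the inverse bookkeeping (an index bijection `e` over an injective
`fε : D.Eps → Eps′` compatible with admissibility, and `φ.symm`-equivariant summand isomorphisms).  One application of
`thm418AsPrinted_transport` at `(D.transport …, φ.symm)` followed by the round trip. [cite: Liu2021, Thm. 4.18 (l. 2232–2245)] -/
theorem thm418AsPrinted_of_transport
    (h' : Liu2021.Thm418AsPrinted (D.transport G' φ Eps' epsOf' Chi' omega' rho'))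
    (e : D.AdmIndex ≃ (D.transport G' φ Eps' epsOf' Chi' omega' rho').AdmIndex)
    (fε : D.Eps → Eps') (hfε : Function.Injective fε)
    (he : ∀ i : D.AdmIndex, (e i).1.1 = fε i.1.1)
    (hadm : ∀ ε : D.Eps, D.IsAdmissible ε → (D.transport G' φ Eps' epsOf' Chi' omega' rho').IsAdmissible (fε ε))
    (Ωᵢ : ∀ i : D.AdmIndex, D.omegaAt i ≃ₗ[ℂ] (D.transport G' φ Eps' epsOf' Chi' omega' rho').omegaAt (e i))
    (hΩ : ∀ (i : D.AdmIndex) (g : D.G) (y : D.omegaAt i),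
      Ωᵢ i (D.rhoAt i g y) = (D.transport G' φ Eps' epsOf' Chi' omega' rho').rhoAt (e i) (φ.symm g) (Ωᵢ i y)) :
    Liu2021.Thm418AsPrinted D := by
  have key := (D.transport G' φ Eps' epsOf' Chi' omega' rho').thm418AsPrinted_transport D.G φ.symm D.Eps D.epsOf D.Chi
    D.omega D.rho h' e fε hfε he hadm Ωᵢ hΩ
  rwa [transport_transport_symm] at key

end RoundTrip

end Thm418Data

end Literature.NumberTheory.Automorphic.Liu2021

end
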